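import Mathlib
import Literature.NumberTheory.LFunctions.Zhang2022.Section13E1Reduction
import Literature.NumberTheory.LFunctions.Zhang2022.Section13MeanSquaresParams
import HarnessLib

/-!
# Zhang (2022) §13 (13.11): the mean square of Lemma 6.1's error `E₁` at the LOSS-FREE scale `𝔓`
# — `Σ_{ψ∈T} E₁(w,ψ)² ≤ C·𝔓·𝓛⁻¹⁰⁴ ≤ C·𝔓·𝓛⁻⁹⁴` on the strip `|Re w − ½| ≤ 2α`

Topic `Literature/NumberTheory/LFunctions/Zhang2022` (Landau–Siegel audit tree; verdict-neutral).
Y. Zhang, *Discrete mean estimates and the Landau–Siegel zero*, arXiv:2211.02515v1 (2022)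
[Zhang2022LandauSiegel], §13 p. 75, (13.11) (tex L3806–L3817: "Combining (2.34), Cauchy's
inequality, Proposition 7.1, Lemma 5.9, 6.1 and 3.3, we can verify that `𝓔 = o(𝔓)`" — NOT carried
out in print, plan/GAP-LEDGER G-L3t6-3) — **an unrefereed manuscript under adjudication**. Lane
ZHANG-L, WP14 §3 (leaf h1311 `Skeleton.Eq1311Rel c′ c137`, owner zl-w14-p5; this file = the item
«E1main² at 𝔓-scale» of the owner's SYNC 2026-08-27T00:28Z, helper zl-closer-2).

In the owner's design of record for (13.11) every `L`-factor is Cauchy–Schwarz'd ALONE against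
`B×(short)`, and `|L(w,ψ)|²` is majorised through Lemma 6.1 by
`4(|K|² + e³²|N̄|² + C²E₁(1−w̄)² + C²ε²)`; the `E₁`-part must then be NEGLIGIBLE against the `K`-part
(`Σ_ψ|K|² ≤ C·𝔓·𝓛⁹`). This theorem-only file (0 definitions, 0 named facts) proves exactly that:

* `norm_sq_E1coeff_le` — the truncated unimodular coefficient `[n < ⌈T³⌉]·n^{−iv}` has
  `|c(n)|² ≤ [n < ⌈T³⌉]`;
* `sum_E1poly_sq_le_frakP` — **the `E₁`-polynomial at scale `𝔓`, uniformly in `v`**: for `𝓛 ≥ 4`,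
  any finite `T ⊆ Ψ`, `|Re w − ½| ≤ 2α` and every real `v`,
  `Σ_{ψ∈T}|Σ_{n<T³}ψ(n)n^{−(w+iv)}|² ≤ e^{8π}·𝔓·(1 + 4𝓛²)` (Lemma 3.3 (i) in the owner's loss-free
  form `Section13MeanSquareTools.meanSq_floorP_le`, length `T³ ≤ P` by
  `Section13MeanSquaresParams.lengths_of_four_le_ell`, `Σ_{n<⌈T³⌉}1/n ≤ 1 + log⌈T³⌉ ≤ 1 + 4𝓛²`);
* `sum_E1main_sq_le_frakP_of_four_le_ell` — pointwise in `D` (`𝓛 ≥ 4`):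
  `Σ_{ψ∈T} E₁(w,ψ)² ≤ 4π·e^{8π}(1+4𝓛²)·𝔓·𝓛³⁰/𝓛¹³⁶` — Cauchy–Schwarz in `v` AGAINST the Gaussian
  (`Section13E1Reduction.sum_E1main_sq_mul_le_of_pointwise` with the weight `g = 1`: the prefactor
  `𝓛⁻¹³⁶` and the Gaussian mass `(2√π𝓛¹⁵)²` are kept EXPLICIT, nothing is rounded);
* **`sum_E1main_sq_le_frakP`** — the owner's requested shape VERBATIM:
  `∃ C ≥ 0, ForAllLarge: ∀ T w, |Re w − ½| ≤ 2α → Σ_{ψ∈T} E₁(w,ψ)² ≤ C·𝔓·(𝓛⁹⁴)⁻¹`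
  (from the sharper `sum_E1main_sq_le_frakP_sharp`: `≤ C·𝔓·(𝓛¹⁰⁴)⁻¹`, `C = 20πe^{8π}`; no
  Assumption (A), no restriction on `Im w`); `sum_E1main_sq_le_frakP_A` = the same in the literal
  frame `ForAllLarge, (A) → ∀ T w, …`.

Exponent bookkeeping (numbers, not adjectives): `−136 + 15 + 15 + 2 = −104 ≤ −94`.
WHAT THIS IS NOT: a proof of (13.11), of Lemma 6.1, or of anything about Theorems 1–2 of the
manuscript / Landau–Siegel zeros.

## References

* Y. Zhang, arXiv:2211.02515v1 (2022), §13 (13.11) p. 75; §6 Lemma 6.1 p. 30 (definition of `E₁`);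
  §3 Lemma 3.3 p. 14. [cite: Zhang2022LandauSiegel, §13 (13.11) p.75]
-/

noncomputable section

open Complex Real MeasureTheory Finset

namespace Literature.NumberTheory.LFunctions.Zhang2022.Typed.Section13

open Skeleton

/-! ## The `E₁`-polynomial at scale `𝔓` -/

/-- The truncated unimodular coefficient of the `E₁`-polynomial, `c(n) = [n < N]·(1·n^{−iv})`, has
`|c(n)|² ≤ [n < N]` for `n ≥ 1`. [cite: Zhang2022LandauSiegel, §6 Lemma 6.1 p.30] -/
theorem norm_sq_E1coeff_le (N : ℕ) (v : ℝ) {n : ℕ} (hn : 1 ≤ n) :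
    ‖(fun m : ℕ => if m < N then (1 : ℂ) * (m : ℂ) ^ (-(v * I : ℂ)) else 0) n‖ ^ 2 ≤
      if n < N then 1 else 0 := by
  by_cases h : n < N
  · simp only [h, if_true, one_mul]
    have hn0 : 0 < n := hn
    have : ‖(n : ℂ) ^ (-(v * I : ℂ))‖ = 1 := by
      rw [Complex.norm_natCast_cpow_of_pos hn0]
      simp
    rw [this, one_pow]
  · simp [h]

/-- `Σ_{1≤n≤K} [n < N]/n ≤ 1 + log N` for `N ≥ 2` (harmonic bound). [folklore] -/
private theorem sum_indicator_div_le_one_add_log (K N : ℕ) (hN : 2 ≤ N) :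
    ∑ n ∈ Icc 1 K, (if n < N then (1 : ℝ) else 0) / n ≤ 1 + Real.log N := by
  have h1 : ∑ n ∈ Icc 1 K, (if n < N then (1 : ℝ) else 0) / n ≤
      ∑ n ∈ Icc 1 (N - 1), (1 : ℝ) / n := by
    calc ∑ n ∈ Icc 1 K, (if n < N then (1 : ℝ) else 0) / n
        = ∑ n ∈ (Icc 1 K).filter (fun n => n < N), (1 : ℝ) / n := by
          rw [Finset.sum_filter]
          refine Finset.sum_congr rfl fun n _ => ?_
          split_ifs <;> simp
      _ ≤ ∑ n ∈ Icc 1 (N - 1), (1 : ℝ) / n := by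
          refine Finset.sum_le_sum_of_subset_of_nonneg (fun n hn => ?_) fun n _ _ => by positivity
          rw [Finset.mem_filter, Finset.mem_Icc] at hn
          rw [Finset.mem_Icc]; omega
  have h2 : ∑ n ∈ Icc 1 (N - 1), (1 : ℝ) / n ≤ 1 + Real.log ((N - 1 : ℕ) : ℝ) := by
    have h := harmonic_le_one_add_log (N - 1)
    rw [harmonic_eq_sum_Icc] at h
    push_cast at h
    simpa [one_div] using h
  have h3 : Real.log ((N - 1 : ℕ) : ℝ) ≤ Real.log N :=
    Real.log_le_log (by exact_mod_cast (show 0 < N - 1 by omega)) (by exact_mod_cast Nat.sub_le N 1)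
  linarith

/-- **The `E₁`-polynomial at scale `𝔓`, uniformly in the shift `v`**: for `𝓛 ≥ 4`, any finite
`T ⊆ Ψ`, `|Re w − ½| ≤ 2α` and every real `v`,
`Σ_{ψ∈T}|Σ_{1≤n<⌈T³⌉}ψ(n)n^{−(w+iv)}|² ≤ e^{8π}·𝔓·(1 + 4𝓛²)` — Lemma 3.3 (i) (orthogonality,
`meanSq_floorP_le`, NO large-sieve loss) for the polynomial of length `T³ ≤ P` with unimodular
coefficients, `Σ_{n<⌈T³⌉}1/n ≤ 1 + log⌈T³⌉ ≤ 1 + 4𝓛²`. [cite: Zhang2022LandauSiegel, §3 Lemma 3.3 p.14; §6 Lemma 6.1 p.30; §13 p.75] -/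
theorem sum_E1poly_sq_le_frakP {D : ℕ} (hL : 4 ≤ ell D) (T : Finset (Chr D)) {w : ℂ}
    (hw : |w.re - 1 / 2| ≤ 2 * alpha D) (v : ℝ) :
    ∑ x ∈ T, ‖∑ n ∈ Ico 1 ⌈bigT D ^ 3⌉₊, x.ψ (n : ZMod x.p) * (n : ℂ) ^ (-(w + v * I))‖ ^ 2 ≤
      Real.exp (8 * π) * frakP D * (1 + 4 * ell D ^ 2) := by
  have hL1 : 1 ≤ ell D := by linarith
  obtain ⟨⟨-, hN2⟩, ⟨-, hlogN, -⟩, -, ⟨-, hK, -⟩⟩ := lengths_of_four_le_ell hL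
  set N : ℕ := ⌈bigT D ^ 3⌉₊ with hNdef
  set K : ℕ := ⌊bigP D⌋₊ with hKdef
  set c : ℕ → ℂ := fun m => if m < N then (1 : ℂ) * (m : ℂ) ^ (-(v * I : ℂ)) else 0 with hcdef
  -- rewrite each polynomial over `1 ≤ n ≤ ⌊P⌋` with the shift inside the coefficients
  have hrew : ∀ x ∈ T, ∑ n ∈ Ico 1 N, x.ψ (n : ZMod x.p) * (n : ℂ) ^ (-(w + v * I)) =
      ∑ n ∈ Icc 1 K, c n * x.ψ (n : ZMod x.p) * (n : ℂ) ^ (-w) := by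
    intro x _
    rw [E1poly_shift_eq_dirPoly x w (v * I)]
    exact sum_Ico_eq_sum_Icc_trunc hK (fun m => (1 : ℂ) * (m : ℂ) ^ (-(v * I : ℂ)))
      (fun m => x.ψ (m : ZMod x.p)) w
  have hfrakP : 0 ≤ frakP D := by
    rw [frakP_eq_sum_primeWindow]; exact Finset.sum_nonneg fun p _ => Nat.cast_nonneg p
  calc ∑ x ∈ T, ‖∑ n ∈ Ico 1 N, x.ψ (n : ZMod x.p) * (n : ℂ) ^ (-(w + v * I))‖ ^ 2
      = ∑ x ∈ T, ‖∑ n ∈ Icc 1 K, c n * x.ψ (n : ZMod x.p) * (n : ℂ) ^ (-w)‖ ^ 2 :=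
        Finset.sum_congr rfl fun x hx => by rw [hrew x hx]
    _ ≤ Real.exp (8 * π) * frakP D * ∑ n ∈ Icc 1 K, ‖c n‖ ^ 2 / n :=
        meanSq_floorP_le hL1 T hw c
    _ ≤ Real.exp (8 * π) * frakP D * ∑ n ∈ Icc 1 K, (if n < N then (1 : ℝ) else 0) / n := by
        refine mul_le_mul_of_nonneg_left (Finset.sum_le_sum fun n hn => ?_) (by positivity)
        have hn1 : 1 ≤ n := (Finset.mem_Icc.mp hn).1
        exact div_le_div_of_nonneg_right (norm_sq_E1coeff_le N v hn1) (Nat.cast_nonneg n)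
    _ ≤ Real.exp (8 * π) * frakP D * (1 + Real.log N) :=
        mul_le_mul_of_nonneg_left (sum_indicator_div_le_one_add_log K N hN2) (by positivity)
    _ ≤ Real.exp (8 * π) * frakP D * (1 + 4 * ell D ^ 2) :=
        mul_le_mul_of_nonneg_left (by linarith) (by positivity)

/-! ## `Σ_ψ E₁²` at scale `𝔓` -/

/-- **`Σ_{ψ∈T} E₁(w,ψ)² ≤ 4π·e^{8π}(1 + 4𝓛²)·𝔓·𝓛³⁰/𝓛¹³⁶`** for `𝓛 ≥ 4`, any finite `T ⊆ Ψ` and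
`|Re w − ½| ≤ 2α` (Cauchy–Schwarz in `v` against the Gaussian `ω₁`, mass `≤ 2√π𝓛¹⁵` used twice,
and `sum_E1poly_sq_le_frakP` at every `v`; the factor `𝓛⁻¹³⁶` is kept).
[cite: Zhang2022LandauSiegel, §6 Lemma 6.1 p.30; §13 (13.11) p.75] -/
theorem sum_E1main_sq_le_frakP_of_four_le_ell {D : ℕ} (hL : 4 ≤ ell D) (T : Finset (Chr D))
    {w : ℂ} (hw : |w.re - 1 / 2| ≤ 2 * alpha D) :
    ∑ x ∈ T, E1main x w ^ 2 ≤
      4 * π * (Real.exp (8 * π) * frakP D * (1 + 4 * ell D ^ 2)) * ell D ^ 30 / ell D ^ 136 := by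
  have hL3 : 3 ≤ ell D := by linarith
  have h := sum_E1main_sq_mul_le_of_pointwise T hL3 w (fun _ => (1 : ℝ)) (fun _ => zero_le_one)
    (M := Real.exp (8 * π) * frakP D * (1 + 4 * ell D ^ 2)) (fun v => by
      simpa only [mul_one] using sum_E1poly_sq_le_frakP hL T hw v)
  simpa only [mul_one] using h

/-- **`Σ_{ψ∈T} E₁(w,ψ)² ≤ C·𝔓·(𝓛¹⁰⁴)⁻¹`** for all large `D`, every finite `T ⊆ Ψ` and
`|Re w − ½| ≤ 2α`, with `C = 20πe^{8π}` (`1 + 4𝓛² ≤ 5𝓛²`; `−136 + 30 + 2 = −104`).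
[cite: Zhang2022LandauSiegel, §6 Lemma 6.1 p.30; §13 (13.11) p.75] -/
theorem sum_E1main_sq_le_frakP_sharp : ∃ C : ℝ, 0 ≤ C ∧ ForAllLarge fun D _ _ =>
    ∀ (T : Finset (Chr D)) (w : ℂ), |w.re - 1 / 2| ≤ 2 * alpha D →
      ∑ x ∈ T, E1main x w ^ 2 ≤ C * frakP D * (ell D ^ 104)⁻¹ := by
  refine ⟨20 * π * Real.exp (8 * π), by positivity, ⌈Real.exp 4⌉₊, fun D _ χ hD _ _ T w hw => ?_⟩
  have hL : 4 ≤ ell D := by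
    have h1 : Real.exp 4 ≤ D := le_trans (Nat.le_ceil _) (by exact_mod_cast hD)
    have := Real.log_le_log (Real.exp_pos 4) h1
    rwa [Real.log_exp] at this
  have hL1 : 1 ≤ ell D := by linarith
  have hL0 : 0 < ell D := by linarith
  have hfrakP : 0 ≤ frakP D := by
    rw [frakP_eq_sum_primeWindow]; exact Finset.sum_nonneg fun p _ => Nat.cast_nonneg p
  have h5 : 1 + 4 * ell D ^ 2 ≤ 5 * ell D ^ 2 := by nlinarith
  calc ∑ x ∈ T, E1main x w ^ 2
      ≤ 4 * π * (Real.exp (8 * π) * frakP D * (1 + 4 * ell D ^ 2)) * ell D ^ 30 / ell D ^ 136 :=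
        sum_E1main_sq_le_frakP_of_four_le_ell hL T hw
    _ ≤ 4 * π * (Real.exp (8 * π) * frakP D * (5 * ell D ^ 2)) * ell D ^ 30 / ell D ^ 136 := by
        gcongr
    _ = 20 * π * Real.exp (8 * π) * frakP D * (ell D ^ 104)⁻¹ := by
        field_simp
        ring

/-- **`Σ_{ψ∈T} E₁(w,ψ)² ≤ C·𝔓·(𝓛⁹⁴)⁻¹`** for all large `D`, every finite `T ⊆ Ψ` and
`|Re w − ½| ≤ 2α` — the shape requested by the (13.11) assembly (zl-w14-p5 SYNC 2026-08-27T00:28Z: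
"E1main² at 𝔓-scale … ≤ C𝔓(𝓛⁹⁴)⁻¹ for |Re w−½| ≤ 2α"), a weakening of
`sum_E1main_sq_le_frakP_sharp` (`𝓛⁻¹⁰⁴ ≤ 𝓛⁻⁹⁴`). No Assumption (A), no restriction on `Im w`.
[cite: Zhang2022LandauSiegel, §6 Lemma 6.1 p.30; §13 (13.11) p.75] -/
theorem sum_E1main_sq_le_frakP : ∃ C : ℝ, 0 ≤ C ∧ ForAllLarge fun D _ _ =>
    ∀ (T : Finset (Chr D)) (w : ℂ), |w.re - 1 / 2| ≤ 2 * alpha D →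
      ∑ x ∈ T, E1main x w ^ 2 ≤ C * frakP D * (ell D ^ 94)⁻¹ := by
  obtain ⟨C, hC0, D₀, hC⟩ := sum_E1main_sq_le_frakP_sharp
  refine ⟨C, hC0, max D₀ ⌈Real.exp 4⌉₊, fun D _ χ hD hq hp T w hw => ?_⟩
  have hL : 4 ≤ ell D := by
    have h1 : Real.exp 4 ≤ D :=
      le_trans (Nat.le_ceil _) (by exact_mod_cast le_trans (le_max_right _ _) hD)
    have := Real.log_le_log (Real.exp_pos 4) h1
    rwa [Real.log_exp] at this
  have hL1 : 1 ≤ ell D := by linarith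
  have hfrakP : 0 ≤ frakP D := by
    rw [frakP_eq_sum_primeWindow]; exact Finset.sum_nonneg fun p _ => Nat.cast_nonneg p
  have h := hC D χ (le_trans (le_max_left _ _) hD) hq hp T w hw
  refine h.trans (mul_le_mul_of_nonneg_left ?_ (mul_nonneg hC0 hfrakP))
  exact inv_anti₀ (by positivity) (pow_le_pow_right₀ hL1 (by norm_num))

/-- The same under Assumption (A) in the binder (the literal frame `ForAllLarge, (A) → ∀ T w, …` of
the (13.11) assembly; (A) is not used). [cite: Zhang2022LandauSiegel, §13 (13.11) p.75] -/
theorem sum_E1main_sq_le_frakP_A : ∃ C : ℝ, 0 ≤ C ∧ ForAllLarge fun D _ χ =>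
    AssumptionA D χ → ∀ (T : Finset (Chr D)) (w : ℂ), |w.re - 1 / 2| ≤ 2 * alpha D →
      ∑ x ∈ T, E1main x w ^ 2 ≤ C * frakP D * (ell D ^ 94)⁻¹ := by
  obtain ⟨C, hC0, D₀, hC⟩ := sum_E1main_sq_le_frakP
  exact ⟨C, hC0, D₀, fun D _ χ hD hq hp _ T w hw => hC D χ hD hq hp T w hw⟩

end Literature.NumberTheory.LFunctions.Zhang2022.Typed.Section13
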